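import Summits.NavierStokesRegularity.NavierStokesRegularity.Theorems.SoloRefuteSilvente2025
import HarnessLib

/-!
# C104 `Silvente2025` — companion: the small-data retype of the Resonant Grönwall inference is false too

Companion to `Theorems/SoloRefuteSilvente2025.lean` (refuter of record: refuter-3; kit typist-5 g3). The
charitable retype of Step 3b of `Literature.Claims.NS.Silvente2025` by a universal smallness threshold on
`E(0)` — `Step_3bSmall C` below, the refined-law analogue of the small-data closure of App. A p.17 (the
print itself says «even without assuming smallness of E(0)», p.11 l.15–16) — is refuted for every `C > 0`
at the print's scalar grain: `E(t) = s²(1 + a t)²`, `a = a(Cs) = min(1/2, (Cs)²/64, Cs/4)`,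
`s = min(1, √(ε/2))`, `D ≡ 0` is admissible, obeys the refined inequality for every `ν`, starts at
`E(0) = s² < ε`, and is unbounded (`not_Step_3bSmall`). The scalar heart of typist-5 g3's estimate is
abstracted as `core_estimate` (`2a(1 + log(1 + J)) ≤ C′(1 + at)²` whenever `0 ≤ J ≤ t(1 + at)²`).

WHAT THIS IS NOT: not a claim about NS regularity or blow-up; not a claim about any author beyond the
typed locator.
-/

-- the cell's Theorems namespace repeats the summit name (convention); silence the duplicate-namespace linter
set_option linter.dupNamespace false

noncomputable section

open Set Real MeasureTheory intervalIntegral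
open Literature.Claims.NS.Silvente2025

namespace Summit.NavierStokesRegularity.NavierStokesRegularity.Theorems.Silvente2025

/-! ### The charitable retype «Step 3b under a universal smallness threshold» is false too -/

/-- **Step 3b weakened by smallness of `E(0)`** — the charitable retype of the Resonant Grönwall inference
(NOT printed: p.11 l.15–16 says «even without assuming smallness of E(0)»; it is the refined-law analogue
of the small-data closure App. A p.17): a universal `ε > 0` below which every admissible pair obeying the
refined inequality has `E` bounded on `[0,∞)`. Recorded to show that smallness rescues nothing of the
refined inference at the print's scalar grain. [cite: Silvente2025, [Resonant Grönwall Inequality] p.11 l.9–17; App. A p.17 l.2–12] -/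
def Step_3bSmall (C : ℝ) : Prop :=
  ∃ ε : ℝ, 0 < ε ∧ ∀ ν : ℝ, 0 < ν → ∀ E D : ℝ → ℝ, Admissible E D → RefinedIneq C ν E D →
    E 0 < ε → BoundedOn0 E

/-- The retype is implied by Step 3b (any threshold). [folklore] -/
theorem step_3bSmall_of_step_3b {C : ℝ} (h : Step_3b C) : Step_3bSmall C :=
  ⟨1, one_pos, fun ν hν E D hadm href _ => h ν hν E D hadm href⟩

/-- `E(t) = s²(1 + at)²`. [folklore] -/
theorem quadProfile_eq (s a t : ℝ) : quadProfile s a t = s ^ 2 * (1 + a * t) ^ 2 := by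
  unfold quadProfile; ring

/-- `E ≥ 0` for every amplitude. [folklore] -/
theorem quadProfile_nonneg (s a t : ℝ) : 0 ≤ quadProfile s a t := by
  unfold quadProfile; positivity

/-- `E` is monotone on `[0,∞)` for `a ≥ 0`. [folklore] -/
theorem quadProfile_mono (s : ℝ) {a : ℝ} (ha : 0 ≤ a) {t' t : ℝ} (h0 : 0 ≤ t') (h : t' ≤ t) :
    quadProfile s a t' ≤ quadProfile s a t := by
  rw [quadProfile_eq, quadProfile_eq]
  have h1 : 0 ≤ 1 + a * t' := by nlinarith [mul_nonneg ha h0]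
  have h2 : 1 + a * t' ≤ 1 + a * t := by nlinarith
  have h3 : (1 + a * t') ^ 2 ≤ (1 + a * t) ^ 2 := by nlinarith [mul_le_mul h2 h2 h1 (h1.trans h2)]
  exact mul_le_mul_of_nonneg_left h3 (sq_nonneg s)

/-- The damping integrand is continuous along every profile. [folklore] -/
theorem continuous_dampIntegrand_amp (s a : ℝ) :
    Continuous fun x => quadProfile s a x / (1 + Real.log (1 + quadProfile s a x)) := by
  have hc : Continuous (quadProfile s a) := by
    unfold quadProfile; fun_prop
  have h1 : ∀ x, 1 + quadProfile s a x ≠ 0 := fun x => by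
    have := quadProfile_nonneg s a x; positivity
  have hlog : Continuous fun x => Real.log (1 + quadProfile s a x) :=
    (continuous_const.add hc).log h1
  refine hc.div (continuous_const.add hlog) fun x => ?_
  have : 0 ≤ Real.log (1 + quadProfile s a x) :=
    Real.log_nonneg (by linarith [quadProfile_nonneg s a x])
  positivity

/-- `0 ≤ I[E](t) ≤ t·E(t)` on `t ≥ 0` for every amplitude and every rate `a ≥ 0`. [folklore] -/
theorem dampI_quadProfile_bounds (s : ℝ) {a : ℝ} (ha : 0 ≤ a) {t : ℝ} (ht : 0 ≤ t) :
    0 ≤ dampI (quadProfile s a) t ∧ dampI (quadProfile s a) t ≤ t * quadProfile s a t := by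
  unfold dampI
  have hpt : ∀ x ∈ Icc (0:ℝ) t, 0 ≤ quadProfile s a x / (1 + Real.log (1 + quadProfile s a x)) := by
    intro x _
    have h0 : 0 ≤ Real.log (1 + quadProfile s a x) :=
      Real.log_nonneg (by linarith [quadProfile_nonneg s a x])
    exact div_nonneg (quadProfile_nonneg s a x) (by linarith)
  refine ⟨intervalIntegral.integral_nonneg ht hpt, ?_⟩
  have hmono : ∀ x ∈ Icc (0:ℝ) t,
      quadProfile s a x / (1 + Real.log (1 + quadProfile s a x)) ≤ quadProfile s a t := by
    intro x hx
    have h0 : 0 ≤ Real.log (1 + quadProfile s a x) :=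
      Real.log_nonneg (by linarith [quadProfile_nonneg s a x])
    exact (div_le_self (quadProfile_nonneg s a x) (by linarith)).trans
      (quadProfile_mono s ha hx.1 hx.2)
  calc ∫ x in (0:ℝ)..t, quadProfile s a x / (1 + Real.log (1 + quadProfile s a x))
      ≤ ∫ _ in (0:ℝ)..t, quadProfile s a t :=
        intervalIntegral.integral_mono_on ht ((continuous_dampIntegrand_amp s a).intervalIntegrable 0 t)
          intervalIntegrable_const hmono
    _ = t * quadProfile s a t := by rw [intervalIntegral.integral_const, sub_zero, smul_eq_mul]

/-- **Core scalar estimate** (typist-5 g3's argument, abstracted): with `a = a(C')`, `q = (1 + at)²`,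
`t ≥ 0` and any `0 ≤ J ≤ t q`: `2a(1 + log(1 + J)) ≤ C' q`. [folklore] -/
theorem core_estimate {C' : ℝ} (hC' : 0 < C') {t J : ℝ} (ht : 0 ≤ t) (hJ0 : 0 ≤ J)
    (hJ : J ≤ t * (1 + aOf C' * t) ^ 2) :
    2 * aOf C' * (1 + Real.log (1 + J)) ≤ C' * (1 + aOf C' * t) ^ 2 := by
  have ha0 := aOf_pos hC'
  have ha1 := aOf_le_half C'
  have ha2 := aOf_le_sq C'
  have ha3 := aOf_le_quarter C'
  set a := aOf C' with ha
  set q := (1 + a * t) ^ 2 with hq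
  have hq1 : 1 ≤ q := by rw [hq]; nlinarith [mul_nonneg ha0.le ht]
  have hq0 : 0 ≤ q := by linarith
  have hlog1 : Real.log (1 + J) ≤ 2 * Real.sqrt (1 + t * q) :=
    (log_one_add_le_two_sqrt hJ0).trans (by gcongr)
  have hkey : a * (1 + t * q) ≤ q ^ 2 := by
    have h1 : q * (1 + 2 * a * t) ≤ q * q := by
      apply mul_le_mul_of_nonneg_left _ hq0
      rw [hq]; nlinarith [mul_nonneg ha0.le ht]
    nlinarith [mul_nonneg (mul_nonneg ha0.le ht) hq0]
  have hsq : (4 * a) ^ 2 * (1 + t * q) ≤ (C' / 2 * q) ^ 2 := by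
    have h16 : (4 * a) ^ 2 ≤ a * C' ^ 2 / 4 := by nlinarith
    have h1tq : 0 ≤ 1 + t * q := by nlinarith [mul_nonneg ht hq0]
    calc (4 * a) ^ 2 * (1 + t * q) ≤ a * C' ^ 2 / 4 * (1 + t * q) :=
          mul_le_mul_of_nonneg_right h16 h1tq
      _ = C' ^ 2 / 4 * (a * (1 + t * q)) := by ring
      _ ≤ C' ^ 2 / 4 * q ^ 2 := by gcongr
      _ = (C' / 2 * q) ^ 2 := by ring
  have hroot : 4 * a * Real.sqrt (1 + t * q) ≤ C' / 2 * q := by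
    have h4a : 0 ≤ 4 * a := by linarith
    have hCq : 0 ≤ C' / 2 * q := by positivity
    calc 4 * a * Real.sqrt (1 + t * q)
        = Real.sqrt ((4 * a) ^ 2) * Real.sqrt (1 + t * q) := by rw [Real.sqrt_sq h4a]
      _ = Real.sqrt ((4 * a) ^ 2 * (1 + t * q)) := by rw [Real.sqrt_mul (sq_nonneg _)]
      _ ≤ Real.sqrt ((C' / 2 * q) ^ 2) := Real.sqrt_le_sqrt hsq
      _ = C' / 2 * q := Real.sqrt_sq hCq
  have h2a : 2 * a ≤ C' / 2 * q := by nlinarith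
  calc 2 * a * (1 + Real.log (1 + J)) ≤ 2 * a * (1 + 2 * Real.sqrt (1 + t * q)) := by
        apply mul_le_mul_of_nonneg_left (by linarith) (by linarith)
    _ = 2 * a + 4 * a * Real.sqrt (1 + t * q) := by ring
    _ ≤ C' / 2 * q + C' / 2 * q := add_le_add h2a hroot
    _ = C' * q := by ring

/-- The SMALL-amplitude profile `E(t) = s²(1 + at)²`, `a = a(Cs)`, `D ≡ 0`, `0 < s ≤ 1`, obeys the refined
inequality on `[0,∞)` for every `ν`. [cite: Silvente2025, [Resonant Grönwall Inequality] p.11 l.9–14] -/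
theorem refinedIneq_quad_amp {C s : ℝ} (hC : 0 < C) (hs0 : 0 < s) (hs1 : s ≤ 1) (ν : ℝ) :
    RefinedIneq C ν (quadProfile s (aOf (C * s))) (fun _ => 0) := by
  intro t ht
  have hCs : 0 < C * s := mul_pos hC hs0
  have ha0 := aOf_pos hCs
  set a := aOf (C * s) with ha
  obtain ⟨hI0, hIle⟩ := dampI_quadProfile_bounds s ha0.le ht
  set I := dampI (quadProfile s a) t with hI
  have hlog0 : 0 ≤ Real.log (1 + I) := Real.log_nonneg (by linarith)
  have hden : 0 < 1 + Real.log (1 + I) := by linarith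
  rw [deriv_quadProfile, sqrt_quadProfile hs0.le ha0.le ht, mul_zero, add_zero, le_div_iff₀ hden,
    quadProfile_eq]
  have hx : 0 < 1 + a * t := by nlinarith [mul_nonneg ha0.le ht]
  -- I ≤ t·s²(1+at)² ≤ t(1+at)²  (s ≤ 1)
  have hJ : I ≤ t * (1 + a * t) ^ 2 := by
    have h1 : s ^ 2 ≤ 1 := by nlinarith
    have h2 : t * (s ^ 2 * (1 + a * t) ^ 2) ≤ t * (1 * (1 + a * t) ^ 2) := by
      apply mul_le_mul_of_nonneg_left _ ht
      exact mul_le_mul_of_nonneg_right h1 (sq_nonneg _)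
    calc I ≤ t * quadProfile s a t := hIle
      _ = t * (s ^ 2 * (1 + a * t) ^ 2) := by rw [quadProfile_eq]
      _ ≤ t * (1 + a * t) ^ 2 := by simpa using h2
  have hcore := core_estimate hCs ht hI0 hJ
  -- 2 s²(1+at)·a·(1+L) = s²(1+at)·[2a(1+L)] ≤ s²(1+at)·[C s (1+at)²]
  have hfac : 0 ≤ s ^ 2 * (1 + a * t) := by positivity
  calc 2 * (s * (1 + a * t)) * (s * a) * (1 + Real.log (1 + I))
      = s ^ 2 * (1 + a * t) * (2 * a * (1 + Real.log (1 + I))) := by ring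
    _ ≤ s ^ 2 * (1 + a * t) * (C * s * (1 + a * t) ^ 2) := mul_le_mul_of_nonneg_left hcore hfac
    _ = C * (s ^ 2 * (1 + a * t) ^ 2 * (s * (1 + a * t))) := by ring

/-- Every amplitude profile is admissible with `D ≡ 0`. [folklore] -/
theorem admissible_quad_amp (s a : ℝ) : Admissible (quadProfile s a) (fun _ => 0) :=
  ⟨differentiable_quadProfile s a, fun t _ => quadProfile_nonneg s a t, fun _ _ => le_rfl⟩

/-- **The small-data retype of Step 3b is false for every `C > 0`**: for every `ε > 0` the profile
`E(t) = s²(1 + a(Cs)t)²`, `s = min(1, √(ε/2))`, `D ≡ 0` is admissible, obeys the refined inequality, has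
`E(0) = s² ≤ ε/2 < ε`, and is unbounded — smallness of `E(0)` rescues nothing of the refined inference.
[cite: Silvente2025, [Resonant Grönwall Inequality] p.11 l.9–17; App. A p.17 l.2–12] -/
theorem not_Step_3bSmall {C : ℝ} (hC : 0 < C) : ¬ Step_3bSmall C := by
  rintro ⟨ε, hε, h⟩
  set s : ℝ := min 1 (Real.sqrt (ε / 2)) with hs
  have hsq0 : 0 < Real.sqrt (ε / 2) := Real.sqrt_pos.2 (by linarith)
  have hs0 : 0 < s := lt_min one_pos hsq0
  have hs1 : s ≤ 1 := min_le_left _ _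
  have hs2 : s ≤ Real.sqrt (ε / 2) := min_le_right _ _
  have hE0 : quadProfile s (aOf (C * s)) 0 < ε := by
    rw [quadProfile_eq, mul_zero, add_zero, one_pow, mul_one]
    have h1 : s ^ 2 ≤ Real.sqrt (ε / 2) ^ 2 := pow_le_pow_left₀ hs0.le hs2 2
    rw [Real.sq_sqrt (by linarith)] at h1
    linarith
  exact not_boundedOn0_quadProfile hs0 (aOf_pos (mul_pos hC hs0))
    (h 1 one_pos _ _ (admissible_quad_amp s _) (refinedIneq_quad_amp hC hs0 hs1 1) hE0)

end Summit.NavierStokesRegularity.NavierStokesRegularity.Theorems.Silvente2025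

-- WHAT THIS IS NOT: not a claim about NS regularity or blow-up; not a claim about any author beyond the typed locator.
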